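import Summits.QuantumFields.YangMills.Theorems.BalabanUVNodesN15KingModelLeaves

/-!
# Route «BalabanUVNodes» (K4 «SpineRates»), node N15 = NE2 — THE KING-MODEL RUNG, part 4: WHAT LEMMA 4.5 IS FOR, DECIDED IN THE MODEL —
# King's covariance tower in the cell's `LocalRate` currency, the n-uniform printed shape recovered through the socket, and THE CONTINUUM LIMIT:
# every entry of King's A = 0 unit-lattice covariance `C^{(k)}(x, y)` CONVERGES as `k → ∞` on every torus, with the geometric tail

Cell `pub-ymgap`, Track A (D-0062), seat `pub-ymgap-dag-n15-d` (R134 seat, strategy s3 «King 1986 Lemma 4.5 (4.38) as the scalar kernel», gen 2).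
`bears_on: R4∕N15`; `--supports stmt-QuantumFields-19676` (K3).  COUNT-NEUTRAL; THEOREMS ONLY (0 `def`, 0 `sorry`); everything by name.

THE PRINT.  [King1986] = C. King, CMP **102** (1986) 649–677: Lemma 4.5 (4.38) p. 674 *«|C^{(k)}(x, y) − C^{(k+n)}(x, y)| ≤ CL^{−k}e^{−δ₀|x−y|}»* — an
estimate UNIFORM IN `n`, whose use in §4 (pp. 675–676) is the existence of the `k → ∞` (continuum, `ε = L^{−k} → 0`) limit of the unit-lattice
fluctuation covariance of the `A = 0` model.  The η-rate node NE2 exists for exactly this purpose in the T⁴ programme (UV4You: the nine spine rates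
feed the Cauchy property of the renormalised trajectory, `T4EtaRateMin.LocalRate.exists_limit`).

CONTENTS.  On every torus `Π_μ ℤ∕(LM_μ)` in every dimension, `L ≥ 2`, `a, m² > 0`, with part 3's tower `kingTower = (k ↦ Δ^{(max k 1)})`, block term
`kingBlock = aL⁻²Q*Q` and constant `C_K = kingC ≤ K₄₅`: `kingC_nonneg`; **`localRate_kingTower`** — the tower's inverses `(Δ^{(k)} + aL⁻²Q*Q)⁻¹(x, y)` read
as `NE2KingTransplant.covTowerReadings` satisfy the cell's typed currency `T4EtaRateMin.LocalRate _ C_K L⁻¹` (b2b's `localRate_of_covarianceTowerRate` on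
part 3's `covarianceTowerRate_kingTower`); **`kingCov_multiStep_rate`** — THE PRINTED n-UNIFORM SHAPE RECOVERED THROUGH THE SOCKET: for `k ≥ 1` and EVERY
`n`, `|C^{(k+n)}(x, y) − C^{(k)}(x, y)| ≤ C_K·L^{−k}∕(1 − L⁻¹)` for part 1's `kingCov` BY NAME (telescoping `T4EtaRateMin.abs_sub_le_of_geomRate`; the decay
factor is dropped by the `LocalRate` currency — the tree's `king_lemma45_torus` keeps it); `kingTower_inv_tendsto`; **`kingCov_tendsto`** — for every
torus and all `x, y` there is `ℓ = C^{(∞)}(x, y)` with `C^{(k)}(x, y) → ℓ` and `|C^{(k)}(x, y) − ℓ| ≤ C_K·L^{−k}∕(1 − L⁻¹)` for all `k ≥ 1`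
(`NE2KingTransplant.covariance_entry_limit`); `kingCov_tendsto_dim4`.

HONEST FRAMING ∕ LIMITS.  King's `A = 0` SCALAR MODEL on a FIXED finite torus (the limit is `k → ∞` at fixed unit lattice, i.e. `ε = L^{−k} → 0` in
King's scaling — one finite-volume continuum limit of a FREE-field block covariance, [folklore]-level once (4.38) is in hand); periodic b.c.; NOT
Bałaban's `C^{(k)}(Λ; U)`; NOT a statement about the carriers of record (NODE 00); NOT a node discharge; typed 28∕28, discharged count untouched;
NOT ℝ⁴ ∕ infinite volume ∕ OS ∕ mass gap ∕ Clay.  Locators only: [King1986] Lemma 4.5 (4.38) p. 674, §4 pp. 675–676.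
-/

noncomputable section

open Filter Topology

namespace Summit.QuantumFields.YangMills.BalabanUVNodes.N15.KingModel

open Literature.MathematicalPhysics.QuantumFieldTheory.Balaban1983to89
open Literature.MathematicalPhysics.QuantumFieldTheory.Balaban1983to89.B5Prop11Plancherel (Tor fine)
open Literature.MathematicalPhysics.QuantumFieldTheory.Balaban1983to89.T4EtaRateMin (LocalRate abs_sub_le_of_geomRate)
open Literature.MathematicalPhysics.QuantumFieldTheory.King1986.Torus (tdistT tdistT_isPseudoDist delta45_pos)
open Summit.QuantumFields.BalabanUV.T4Continuum.NE2KingTransplant (covTowerReadings localRate_of_covarianceTowerRate covariance_entry_limit)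

section Limit

variable {dd : ℕ} {a m2 : ℝ} {L : ℕ} [NeZero L] {M : Fin dd → ℕ} [∀ μ, NeZero (M μ)]

omit [NeZero L] in
/-- `C_K ≥ 0`. [folklore] -/
theorem kingC_nonneg (dd : ℕ) (a : ℝ) (L : ℕ) : 0 ≤ kingC dd a L := by
  unfold kingC; positivity

omit [NeZero L] in
/-- `0 ≤ L⁻¹ < 1` for `L ≥ 2`. [folklore] -/
theorem inv_L_nonneg_lt_one (hL : 2 ≤ L) : 0 ≤ ((L : ℝ))⁻¹ ∧ ((L : ℝ))⁻¹ < 1 :=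
  ⟨inv_nonneg.mpr (Nat.cast_nonneg L), inv_lt_one_of_one_lt₀ (by exact_mod_cast hL)⟩

/-- **KING'S COVARIANCE TOWER IN THE CELL'S `LocalRate` CURRENCY**: the readings `k ↦ (Δ^{(max k 1)} + aL⁻²Q*Q)⁻¹(x, y)` of part 3's tower, indexed
by the pairs `(x, y)` of a torus (`NE2KingTransplant.covTowerReadings`), satisfy `T4EtaRateMin.LocalRate _ C_K L⁻¹` (`L ≥ 2`, `a, m² > 0`).
[cite: King1986, Lemma 4.5 (4.38) p.674] -/
theorem localRate_kingTower (ha : 0 < a) (hm : 0 < m2) (hL : 2 ≤ L) :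
    LocalRate (covTowerReadings (kingTower a m2 L M) (kingBlock a L M)) (kingC dd a L) ((L : ℝ)⁻¹) :=
  localRate_of_covarianceTowerRate (kingC_nonneg dd a L) (inv_L_nonneg_lt_one hL).1 (delta45_pos (d := dd) ha hL).le
    (tdistT_isPseudoDist (fine L M)).nonneg (covarianceTowerRate_kingTower ha hm hL)

/-- **THE ENTRYWISE LIMIT OF THE TOWER'S INVERSES WITH THE GEOMETRIC TAIL**: for all `x, y` there is `ℓ` with `(Δ^{(max k 1)} + aL⁻²Q*Q)⁻¹(x, y) → ℓ`
and `|(Δ^{(max k 1)} + aL⁻²Q*Q)⁻¹(x, y) − ℓ| ≤ C_K·L^{−k}∕(1 − L⁻¹)` for every `k` (`NE2KingTransplant.covariance_entry_limit`). [cite: King1986, Lemma 4.5 (4.38) p.674, §4 pp.675–676] -/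
theorem kingTower_inv_tendsto (ha : 0 < a) (hm : 0 < m2) (hL : 2 ≤ L) (x y : Tor (fine L M)) :
    ∃ ℓ : ℝ, Tendsto (fun k => (kingTower a m2 L M k + kingBlock a L M)⁻¹ x y) atTop (𝓝 ℓ) ∧
      ∀ k, |(kingTower a m2 L M k + kingBlock a L M)⁻¹ x y - ℓ| ≤ kingC dd a L * ((L : ℝ)⁻¹) ^ k / (1 - (L : ℝ)⁻¹) :=
  covariance_entry_limit (kingC_nonneg dd a L) (inv_L_nonneg_lt_one hL).1 (inv_L_nonneg_lt_one hL).2 (delta45_pos (d := dd) ha hL).le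
    (tdistT_isPseudoDist (fine L M)).nonneg (covarianceTowerRate_kingTower ha hm hL) x y

end Limit

section ByName

variable {d : ℕ} {a m2 : ℝ} {L : ℕ} [NeZero L]

/-- **THE PRINTED n-UNIFORM SHAPE OF (4.38), RECOVERED THROUGH THE SOCKET** (decay dropped by the `LocalRate` currency): on every torus, for
`k ≥ 1`, EVERY `n` and all sites, `|C^{(k+n)}(x, y) − C^{(k)}(x, y)| ≤ C_K·L^{−k}∕(1 − L⁻¹)` for part 1's `C^{(·)} = kingCov` BY NAME — the one-step
tower rate telescoped (`T4EtaRateMin.abs_sub_le_of_geomRate`), constant independent of `n` as printed. [cite: King1986, Lemma 4.5 (4.38) p.674] -/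
theorem kingCov_multiStep_rate (ha : 0 < a) (hm : 0 < m2) (hL : 2 ≤ L) (M : Fin (d + 1) → ℕ) [∀ μ, NeZero (M μ)] {k : ℕ}
    (hk : 1 ≤ k) (n : ℕ) (x y : Tor (fine L M)) :
    |kingCov L M a m2 (L ^ (k + n)) (k + n) x y - kingCov L M a m2 (L ^ k) k x y|
      ≤ kingC (d + 1) a L * ((L : ℝ)⁻¹) ^ k / (1 - (L : ℝ)⁻¹) := by
  have h := abs_sub_le_of_geomRate (u := fun j => (covTowerReadings (kingTower a m2 L M) (kingBlock a L M)).loc j () (x, y))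
    (inv_L_nonneg_lt_one hL).1 (inv_L_nonneg_lt_one hL).2
    ((localRate_kingTower (M := M) ha hm hL).geomRate (V := ()) (Set.mem_univ _) (x, y)) k n
  have e1 : (covTowerReadings (kingTower a m2 L M) (kingBlock a L M)).loc (k + n) () (x, y) = kingCov L M a m2 (L ^ (k + n)) (k + n) x y := by
    show (kingTower a m2 L M (k + n) + kingBlock a L M)⁻¹ x y = _
    rw [kingTower_of_one_le (by omega : 1 ≤ k + n)]; rfl
  have e2 : (covTowerReadings (kingTower a m2 L M) (kingBlock a L M)).loc k () (x, y) = kingCov L M a m2 (L ^ k) k x y := by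
    show (kingTower a m2 L M k + kingBlock a L M)⁻¹ x y = _
    rw [kingTower_of_one_le hk]; rfl
  rw [e1, e2] at h
  exact h

/-- **THE CONTINUUM LIMIT OF KING'S A = 0 UNIT-LATTICE COVARIANCE, ON EVERY TORUS — what Lemma 4.5 is for, decided in the model**: for every torus
`Π_μ ℤ∕(LM_μ)` (`μ < d + 1`), `L ≥ 2`, `a, m² > 0` and all sites `x, y` there is `ℓ = C^{(∞)}(x, y)` such that part 1's `C^{(k)}(x, y) = kingCov … (L^k) k x y`
TENDS TO `ℓ` as `k → ∞`, with the geometric tail `|C^{(k)}(x, y) − ℓ| ≤ C_K·L^{−k}∕(1 − L⁻¹)` for all `k ≥ 1` (`C_K = kingC ≤ K₄₅`).  HONEST SCOPE: one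
finite torus, free scalar field, periodic b.c.; NOT Bałaban's covariances; count-neutral. [cite: King1986, Lemma 4.5 (4.38) p.674, §4 pp.675–676] -/
theorem kingCov_tendsto (ha : 0 < a) (hm : 0 < m2) (hL : 2 ≤ L) (M : Fin (d + 1) → ℕ) [∀ μ, NeZero (M μ)] (x y : Tor (fine L M)) :
    ∃ ℓ : ℝ, Tendsto (fun k => kingCov L M a m2 (L ^ k) k x y) atTop (𝓝 ℓ) ∧
      ∀ k, 1 ≤ k → |kingCov L M a m2 (L ^ k) k x y - ℓ| ≤ kingC (d + 1) a L * ((L : ℝ)⁻¹) ^ k / (1 - (L : ℝ)⁻¹) := by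
  obtain ⟨ℓ, h1, h2⟩ := kingTower_inv_tendsto (M := M) ha hm hL x y
  refine ⟨ℓ, h1.congr' ?_, fun k hk => ?_⟩
  · filter_upwards [eventually_ge_atTop 1] with k hk
    rw [kingTower_of_one_le hk]
    rfl
  · have h := h2 k
    rw [kingTower_of_one_le hk] at h
    exact h

/-- **THE FOUR-TORUS INSTANCE** (`d + 1 = 4`, the dimension of the T⁴ programme). [cite: King1986, Lemma 4.5 (4.38) p.674, §4 pp.675–676] -/
theorem kingCov_tendsto_dim4 (ha : 0 < a) (hm : 0 < m2) (hL : 2 ≤ L) (M : Fin 4 → ℕ) [∀ μ, NeZero (M μ)] (x y : Tor (fine L M)) :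
    ∃ ℓ : ℝ, Tendsto (fun k => kingCov L M a m2 (L ^ k) k x y) atTop (𝓝 ℓ) ∧
      ∀ k, 1 ≤ k → |kingCov L M a m2 (L ^ k) k x y - ℓ| ≤ kingC 4 a L * ((L : ℝ)⁻¹) ^ k / (1 - (L : ℝ)⁻¹) :=
  kingCov_tendsto (d := 3) ha hm hL M x y

end ByName

end Summit.QuantumFields.YangMills.BalabanUVNodes.N15.KingModel

end
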